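import Summits.Langlands.Langlands.Theorems.IrreducibilityBySelfDualityIrreducibleOffSectorOpenRegionsV3
import Literature.NumberTheory.Automorphic.GL4NonSelfDualIrreducible
import HarnessLib

/-!
# `IrreducibleOffSector` from its open regions, v4: rank four over totally real fields
(crux stmt-Langlands-14329 `IrreducibilityBySelfDuality.IrreducibleOffSector`, line `Sketch`;
`--supports` file, STRUCTURAL: no import of the route module; continuation lead c6)

The certified map v3 (p124652) asks the open region `H4att` — irreducibility of the semisimple
representation attached (lang.S27) to a regular algebraic cuspidal `π'` on `GL_n(𝔸_K)`, `n ≥ 4`, `K`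
totally real or CM — in full.  Its first printed piece is now in the tree: Shavali 2026, Theorem A
(arXiv:2603.19768; the named fact `isIrreducible_galoisRep_gl4_totallyReal_of_not_essSelfDual` of
`Literature/NumberTheory/Automorphic/GL4NonSelfDualIrreducible`, p125475): for `n = 4`, `K` totally
real and `π'` NOT essentially self-dual (at Satake level: no cuspidal `GL(1)` datum `η` with
`t_{π',v}⁻¹ = η(ϖ_v) t_{π',v}` a.e.) every attached `r` is irreducible, at every `ι`.  This v4 map
therefore asks `H4att'` = `H4att` minus that case (premise: `n = 4 → K totally real → π'` essentially
self-dual at Satake level), and is otherwise v3 verbatim (`irreducibleOffSector_text_of_open_regions_v4`).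

So, modulo printed theorems (lang.S27, Böckle–Hui 1.1/1.2, Clozel's Hecke field, Jacquet–Shalika
(2.2), Shavali 2026 Thm A), the crux is equivalent to the conjunction of: BG 3.1.6 for residual
irregular cuspidal `GL_2`; `H4att'` (whose `n = 4` totally-real part is the ESSENTIALLY SELF-DUAL case:
symmetric cubes — the target of the symmetric-power ascent `…SymmPowerAscent` —, Ramakrishnan tensor
products — the tensor ascent p124532 —, Asai transfers and primitive `GSp_4` type); and the three
residual regions `H3irr'`, `H3esd'`, `H4rest'`.

References: A. Shavali, arXiv:2603.19768 (2026), Thm. A, Cor. 4.6; K. Buzzard, T. Gee, LMS LNS 414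
(2014), Conj. 3.1.6; G. Böckle, C.-Y. Hui, Math. Ann. 393 (2025), Thms. 1.1–1.2; M. Asgari,
A. Raghuram, *A cuspidality criterion for the exterior square transfer of cusp forms on GL(4)* (2011).
-/

noncomputable section

set_option linter.dupNamespace false

open scoped NumberField Classical
open Filter IsDedekindDomain NumberField
open Literature.NumberTheory.Automorphic Literature.NumberTheory.GaloisRepresentations
open Summit.Langlands

namespace Summit.Langlands.Langlands.Theorems.IrreducibleOffSector

/-- **Dispatch of the attached-representation region in rank `≥ 4`** (the new step of the v4 map):
for `K` totally real or CM, `π'` regular algebraic cuspidal on `GL_n(𝔸_K)`, `n ≥ 4`, and `r` semisimple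
attached to `(π', ι)` in the C-normalisation, `r` is irreducible — by Shavali's theorem (`h4S`) when
`n = 4`, `K` is totally real and `π'` is not essentially self-dual at Satake level, and by the residual
hypothesis `H4att'` (stated for this `π'`: premise "`n = 4 → K` totally real `→ π'` essentially
self-dual") otherwise. [claim: Shavali2026GL4, status: under-review] -/
theorem isIrreducible_attached_of_shavali_or_residual
    (h4S : isIrreducible_galoisRep_gl4_totallyReal_of_not_essSelfDual)
    {n : ℕ} {K : Type} [Field K] [NumberField K] (hK : IsTotallyReal K ∨ IsCMField K)
    (hcpt : isCompact_glFiniteIntegralLevel n K) (π' : CuspidalAutomorphicRepData n K hcpt)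
    (hRA : π'.1.IsRegularAlgebraic) {ℓ : ℕ} [Fact ℓ.Prime] (ι : PadicAlgCl ℓ ≃+* ℂ)
    (H4att'π : (n = 4 → IsTotallyReal K → ∃ (h1 : isCompact_glFiniteIntegralLevel 1 K)
        (η : CuspidalAutomorphicRepData 1 K h1), ∀ᶠ v : HeightOneSpectrum (𝓞 K) in cofinite,
          ∀ β : Multiset ℂ, π'.1.HasSatakeParamAt v β →
            ∃ c : ℂ, η.1.HasSatakeParamAt v {c} ∧ β.map (fun a => a⁻¹) = β.map (fun a => c * a)) →
      ∀ r : FramedGaloisRep K (PadicAlgCl ℓ) n, r.toGaloisRep.IsSemisimple →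
        (∀ (v : HeightOneSpectrum (𝓞 K)) (β : Multiset ℂ), π'.1.HasSatakeParamAt v β →
          ((ℓ : ℕ) : 𝓞 K) ∉ v.asIdeal →
            r.IsUnramifiedAt v ∧ r.HasFrobCharpolyAt v (arithFrobPolyOfSatake ι v.residueCard n β)) →
        r.toGaloisRep.IsIrreducible)
    (r : FramedGaloisRep K (PadicAlgCl ℓ) n) (hss : r.toGaloisRep.IsSemisimple)
    (hr : ∀ (v : HeightOneSpectrum (𝓞 K)) (β : Multiset ℂ), π'.1.HasSatakeParamAt v β →
      ((ℓ : ℕ) : 𝓞 K) ∉ v.asIdeal →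
        r.IsUnramifiedAt v ∧ r.HasFrobCharpolyAt v (arithFrobPolyOfSatake ι v.residueCard n β)) :
    r.toGaloisRep.IsIrreducible := by
  by_cases hS : n = 4 ∧ IsTotallyReal K ∧ ¬ ∃ (h1 : isCompact_glFiniteIntegralLevel 1 K)
      (η : CuspidalAutomorphicRepData 1 K h1), ∀ᶠ v : HeightOneSpectrum (𝓞 K) in cofinite,
        ∀ β : Multiset ℂ, π'.1.HasSatakeParamAt v β →
          ∃ c : ℂ, η.1.HasSatakeParamAt v {c} ∧ β.map (fun a => a⁻¹) = β.map (fun a => c * a)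
  · obtain ⟨rfl, hTR, hnsd⟩ := hS
    have h1 : isCompact_glFiniteIntegralLevel 1 K := isCompact_glFiniteIntegralLevel_holds 1 K
    exact h4S K hTR h1 hcpt π' hRA (fun η hη => hnsd ⟨h1, η, hη⟩) ℓ ι r hss hr
  · have _ := hK
    refine H4att'π (fun hn4 hTR => ?_) r hss hr
    by_contra hne
    exact hS ⟨hn4, hTR, hne⟩

/-- **The crux from its open regions, v4 (rank four over totally real fields: the non-self-dual case
is a printed theorem).**  As v3 (`irreducibleOffSector_text_of_open_regions_v3`), except that the
attached-representation region `H4att` is asked only OFF the case `n = 4`, `K` totally real, `π'` not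
essentially self-dual at Satake level (`H4att'`: its premise "`n = 4 → K totally real → π'` essentially
self-dual" is the complement), that case being Shavali's 2026 theorem (the named fact
`isIrreducible_galoisRep_gl4_totallyReal_of_not_essSelfDual`, `h4S`).  GIVEN the printed inputs
(lang.S27 `h27`, Böckle–Hui 1.1 `hWA` / 1.2 `hBH`, Clozel's Hecke field `hHE`, Arthur–Clozel (2.2)
`h22`, Shavali 2026 Thm A `h4S`), `hLA2res`, `H3irr'`, `H3esd'`, `H4att'`, `H4rest'`, the text of
`IrreducibleOffSector` holds verbatim.
[cite: BuzzardGeeLMS2014, Conj. 3.1.6] [cite: BockleHui2025, Theorem 1.1 and Theorem 1.2]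
[claim: Shavali2026GL4, status: under-review] -/
theorem irreducibleOffSector_text_of_open_regions_v4
    (h27 : exists_galoisRep_of_regularAlgebraic)
    (hBH : isIrreducible_galoisRep_gl3_totallyReal)
    (h4S : isIrreducible_galoisRep_gl4_totallyReal_of_not_essSelfDual)
    (hWA : ∀ (K : Type) [Field K] [NumberField K] (h1 : isCompact_glFiniteIntegralLevel 1 K) (ℓ : ℕ) [Fact ℓ.Prime] (n : ℕ) (E : Type) [Field E] [NumberField E] (e : E →+* PadicAlgCl ℓ) (ρ : FramedGaloisRep K (PadicAlgCl ℓ) n), ρ.toGaloisRep.IsSemisimple → (∀ᶠ v in cofinite, ρ.IsUnramifiedAt v ∧ ∃ P : Polynomial E, ρ.HasFrobCharpolyAt v (P.map e)) → ∀ (ψ : FramedGaloisRep K (PadicAlgCl ℓ) 1), (∀ᶠ v in cofinite, ρ.IsUnramifiedAt v ∧ ψ.IsUnramifiedAt v ∧ ∀ 𝔓 ∈ v.primesAbove, ∀ σ : Field.absoluteGaloisGroup K, IsArithFrobAt (𝓞 K) σ 𝔓 → ψ.charpoly σ ∣ ρ.charpoly σ) → ∀ (ι : PadicAlgCl ℓ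 ≃+* ℂ), ∃ χ : CuspidalAutomorphicRepData 1 K h1, χ.1.IsRegularAlgebraic ∧ ∀ᶠ v in cofinite, ∃ c : ℂ, χ.1.HasSatakeParamAt v {c} ∧ ψ.IsUnramifiedAt v ∧ ψ.HasFrobCharpolyAt v (arithFrobPolyOfSatake ι v.residueCard 1 {c}))
    (hHE : Clozel1990_heckeEigenvalueField)
    (h22 : JacquetShalika1981_partialPairL_boundary_repData)
    (hLA2res : ∀ (K : Type) [Field K] [NumberField K] (hcpt : isCompact_glFiniteIntegralLevel 2 K)
      (π : CuspidalAutomorphicRepData 2 K hcpt), π.1.IsLAlgebraic →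
        (¬ ∃ T : InfinityType K 2, π.1.HasInfinityType T ∧ T.IsRegular) →
        (¬ ∃ σ : FramedArtinRep K 2, σ.toGaloisRep.IsIrreducible ∧ IsPiOfArtinRep σ π.1) →
        (¬ ∃ (E : Type) (_ : Field E) (_ : NumberField E) (_ : Algebra K E) (_ : IsGalois K E)
            (h1 : isCompact_glFiniteIntegralLevel 1 E) (τ : AutomorphicRepData (AutomorphyDatum.gl 1 E h1)),
            τ.IsLAlgebraic ∧ IsAutomorphicInductionAlong τ π.1 ∧
            ∀ g : E ≃ₐ[K] E, g ≠ 1 →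
              ¬ ∀ᶠ w : HeightOneSpectrum (𝓞 E) in cofinite, ∀ α : Multiset ℂ,
                  τ.HasSatakeParamAt w α → τ.HasSatakeParamAt (g • w) α) →
        ∃ E : Subfield ℂ, FiniteDimensional ℚ E ∧
          ∀ᶠ v in cofinite, ∀ α : Multiset ℂ, π.1.HasSatakeParamAt v α →
            ∀ i ≤ 2, α.esymm i ∈ E)
    (H3irr' : ∀ (K : Type) [Field K] [NumberField K] (hcpt : isCompact_glFiniteIntegralLevel 3 K)
      (π : CuspidalAutomorphicRepData 3 K hcpt), π.1.IsLAlgebraic →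
        (¬ ∃ T : InfinityType K 3, π.1.HasInfinityType T ∧ T.IsRegular) →
        (¬ ∃ σ : FramedArtinRep K 3, σ.toGaloisRep.IsIrreducible ∧ IsPiOfArtinRep σ π.1) →
        (¬ ∃ (E : Type) (_ : Field E) (_ : NumberField E) (_ : Algebra K E) (_ : IsGalois K E)
            (h1 : isCompact_glFiniteIntegralLevel 1 E) (τ : AutomorphicRepData (AutomorphyDatum.gl 1 E h1)),
            τ.IsLAlgebraic ∧ IsAutomorphicInductionAlong τ π.1 ∧
            ∀ g : E ≃ₐ[K] E, g ≠ 1 →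
              ¬ ∀ᶠ w : HeightOneSpectrum (𝓞 E) in cofinite, ∀ α : Multiset ℂ,
                  τ.HasSatakeParamAt w α → τ.HasSatakeParamAt (g • w) α) →
          ∀ (ℓ : ℕ) [Fact ℓ.Prime] (ι : PadicAlgCl ℓ ≃+* ℂ) (ρ : FramedGaloisRep K (PadicAlgCl ℓ) 3),
            (∀ᶠ v in cofinite, SatakeFrobCompatibleAt ι π.1 ρ v) →
              ρ.toGaloisRep.IsIrreducible)
    (H3esd' : ∀ (K : Type) [Field K] [NumberField K], ¬ IsTotallyReal K → ¬ IsCMField K →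
      ∀ (h1 : isCompact_glFiniteIntegralLevel 1 K) (hcpt : isCompact_glFiniteIntegralLevel 3 K)
        (π : CuspidalAutomorphicRepData 3 K hcpt), π.1.IsLAlgebraic →
          (∃ T : InfinityType K 3, π.1.HasInfinityType T ∧ T.IsRegular) →
            (∃ η : CuspidalAutomorphicRepData 1 K h1, ∀ᶠ v in cofinite,
              ∀ α : Multiset ℂ, π.1.HasSatakeParamAt v α →
                ∃ c : ℂ, η.1.HasSatakeParamAt v {c} ∧ α.map (fun a => a⁻¹) = α.map (fun a => c * a)) →
            (¬ ∃ σ : FramedArtinRep K 3, σ.toGaloisRep.IsIrreducible ∧ IsPiOfArtinRep σ π.1) →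
            (¬ ∃ (E : Type) (_ : Field E) (_ : NumberField E) (_ : Algebra K E) (_ : IsGalois K E)
                (h1 : isCompact_glFiniteIntegralLevel 1 E)
                (τ : AutomorphicRepData (AutomorphyDatum.gl 1 E h1)),
                τ.IsLAlgebraic ∧ IsAutomorphicInductionAlong τ π.1 ∧
                ∀ g : E ≃ₐ[K] E, g ≠ 1 →
                  ¬ ∀ᶠ w : HeightOneSpectrum (𝓞 E) in cofinite, ∀ α : Multiset ℂ,
                      τ.HasSatakeParamAt w α → τ.HasSatakeParamAt (g • w) α) →
              ∀ (ℓ : ℕ) [Fact ℓ.Prime] (ι : PadicAlgCl ℓ ≃+* ℂ) (ρ : FramedGaloisRep K (PadicAlgCl ℓ) 3),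
                (∀ᶠ v in cofinite, SatakeFrobCompatibleAt ι π.1 ρ v) →
                  ρ.toGaloisRep.IsIrreducible)
    (H4att' : ∀ (n : ℕ), 4 ≤ n → ∀ (K : Type) [Field K] [NumberField K], (IsTotallyReal K ∨ IsCMField K) →
      ∀ (hcpt : isCompact_glFiniteIntegralLevel n K) (π' : CuspidalAutomorphicRepData n K hcpt),
        π'.1.IsRegularAlgebraic →
          (n = 4 → IsTotallyReal K → ∃ (h1 : isCompact_glFiniteIntegralLevel 1 K)
              (η : CuspidalAutomorphicRepData 1 K h1), ∀ᶠ v in cofinite,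
                ∀ β : Multiset ℂ, π'.1.HasSatakeParamAt v β →
                  ∃ c : ℂ, η.1.HasSatakeParamAt v {c} ∧ β.map (fun a => a⁻¹) = β.map (fun a => c * a)) →
          ∀ (ℓ : ℕ) [Fact ℓ.Prime] (ι : PadicAlgCl ℓ ≃+* ℂ) (r : FramedGaloisRep K (PadicAlgCl ℓ) n),
            r.toGaloisRep.IsSemisimple →
              (∀ (v : HeightOneSpectrum (𝓞 K)) (β : Multiset ℂ), π'.1.HasSatakeParamAt v β →
                ((ℓ : ℕ) : 𝓞 K) ∉ v.asIdeal →
                  r.IsUnramifiedAt v ∧ r.HasFrobCharpolyAt v (arithFrobPolyOfSatake ι v.residueCard n β)) →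
              r.toGaloisRep.IsIrreducible)
    (H4rest' : ∀ (n : ℕ), 4 ≤ n → ∀ (K : Type) [Field K] [NumberField K]
      (hcpt : isCompact_glFiniteIntegralLevel n K) (π : CuspidalAutomorphicRepData n K hcpt),
        π.1.IsLAlgebraic →
          ¬ ((IsTotallyReal K ∨ IsCMField K) ∧ ∃ T : InfinityType K n, π.1.HasInfinityType T ∧ T.IsRegular) →
          (¬ ∃ σ : FramedArtinRep K n, σ.toGaloisRep.IsIrreducible ∧ IsPiOfArtinRep σ π.1) →
          (¬ ∃ (E : Type) (_ : Field E) (_ : NumberField E) (_ : Algebra K E) (_ : IsGalois K E)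
              (h1 : isCompact_glFiniteIntegralLevel 1 E)
              (τ : AutomorphicRepData (AutomorphyDatum.gl 1 E h1)),
              τ.IsLAlgebraic ∧ IsAutomorphicInductionAlong τ π.1 ∧
              ∀ g : E ≃ₐ[K] E, g ≠ 1 →
                ¬ ∀ᶠ w : HeightOneSpectrum (𝓞 E) in cofinite, ∀ α : Multiset ℂ,
                    τ.HasSatakeParamAt w α → τ.HasSatakeParamAt (g • w) α) →
            ∀ (ℓ : ℕ) [Fact ℓ.Prime] (ι : PadicAlgCl ℓ ≃+* ℂ) (ρ : FramedGaloisRep K (PadicAlgCl ℓ) n),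
              (∀ᶠ v in cofinite, SatakeFrobCompatibleAt ι π.1 ρ v) → ρ.toGaloisRep.IsIrreducible) :
    ∀ (n : ℕ) (K : Type) [Field K] [NumberField K] (hcpt : isCompact_glFiniteIntegralLevel n K), 0 < n → ∀ (π : CuspidalAutomorphicRepData n K hcpt), π.1.IsLAlgebraic → ¬ (n = 3 ∧ IsCMField K ∧ ∃ T : InfinityType K n, π.1.HasInfinityType T ∧ T.IsRegular) → ∀ (ℓ : ℕ) [Fact ℓ.Prime] (ι : PadicAlgCl ℓ ≃+* ℂ) (ρ : FramedGaloisRep K (PadicAlgCl ℓ) n), (∀ᶠ v : HeightOneSpectrum (𝓞 K) in cofinite, SatakeFrobCompatibleAt ι π.1 ρ v) → ρ.toGaloisRep.IsIrreducible := by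
  intro n K _ _ hcpt hn π hL hsec ℓ _ ι ρ hρ
  rcases le_or_gt 4 n with h4 | h4
  · -- rank `≥ 4`
    haveI : NeZero n := ⟨by omega⟩
    by_cases hc : (IsTotallyReal K ∨ IsCMField K) ∧ ∃ T : InfinityType K n, π.1.HasInfinityType T ∧ T.IsRegular
    · -- `n = 4`, `K` totally real, `π'` not essentially self-dual: Shavali 2026; otherwise `H4att'`
      exact isIrreducible_of_isRegular_of_galoisRep_irreducible (fun n K _ _ hcpt => h27 hcpt) hc.1 ι
        (fun π' hRA r hss hr => isIrreducible_attached_of_shavali_or_residual h4S hc.1 hcpt π' hRA ι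
          (fun hp => H4att' n h4 K hc.1 hcpt π' hRA hp ℓ ι) r hss hr) π hL hc.2 ρ hρ
    · exact conclusion_of_not_galoisType_not_monomial π ι
        (fun hG hM => H4rest' n h4 K hcpt π hL hc hG hM ℓ ι) ρ hρ
  interval_cases n
  · -- rank one
    exact isIrreducible_of_rank_one ρ
  · -- rank two: regular → Clozel + JS (p115614); Galois type / monomial → landed regions; else BG 3.1.6
    exact conclusion_rank_two_of_isRegular_or_residual_isLArithmetic hWA hHE h22 π hL
      (hLA2res K hcpt π hL) ι ρ hρ
  · -- rank three
    by_cases hreg : ∃ T : InfinityType K 3, π.1.HasInfinityType T ∧ T.IsRegular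
    · by_cases hTR : IsTotallyReal K
      · exact isIrreducible_rank_three_totallyReal_of_isRegular (fun n K _ _ hcpt => h27 hcpt) hBH hTR π
          hL hreg ι ρ hρ
      by_cases hCM : IsCMField K
      · exact absurd ⟨rfl, hCM, hreg⟩ hsec
      have h1 : isCompact_glFiniteIntegralLevel 1 K := isCompact_glFiniteIntegralLevel_holds 1 K
      by_cases hesd : ∃ η : CuspidalAutomorphicRepData 1 K h1,
          ∀ᶠ v : HeightOneSpectrum (𝓞 K) in cofinite, ∀ α : Multiset ℂ, π.1.HasSatakeParamAt v α →
            ∃ c : ℂ, η.1.HasSatakeParamAt v {c} ∧ α.map (fun a => a⁻¹) = α.map (fun a => c * a)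
      · exact conclusion_of_not_galoisType_not_monomial π ι
          (fun hG hM => H3esd' K hTR hCM h1 hcpt π hL hreg hesd hG hM ℓ ι) ρ hρ
      · exact isIrreducible_rank_three_of_isRegular_of_not_essSelfDual hWA hHE h22 h1 π hL hreg
          (fun η hη => hesd ⟨η, hη⟩) ι ρ hρ
    · exact conclusion_of_not_galoisType_not_monomial π ι
        (fun hG hM => H3irr' K hcpt π hL hreg hG hM ℓ ι) ρ hρ

end Summit.Langlands.Langlands.Theorems.IrreducibleOffSector

end
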